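import Literature.Analysis.FluidPDE.HarmonicBallMeanValue
import Literature.Analysis.FluidPDE.HelmholtzAnnihilator
import Literature.Analysis.FunctionSpaces.MollificationLocal
import HarnessLib

/-!
# Interior `L^∞–L¹` estimate for weakly harmonic functions on a ball

Analysis/FluidPDE support file (theorems only, no definitions, no named facts) on the
decomposition path of the named fact `Literature.Analysis.FluidPDE.seregin_sverak_pressure_decay`
(`PressureDecayEstimate.lean`: Seregin–Šverák 2009, (as13), the decay estimate for the pressure
of a distributional Navier–Stokes solution). The printed mechanism behind that estimate — and
behind Rusin–Šverák's proof of Lemma 2.1, Seregin 2005 (p12), Seregin 2014 Lemma 6.4,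
Robinson–Rodrigo–Sadowski Lemma 16.7 — splits the pressure on a ball as `p = p₁ + p₂` with `p₂`
**harmonic in `x`** and bounds `p₂` by "classical estimates for harmonic functions":

  `sup_{x ∈ B(r/2)} |p₂(x)| ≤ c r⁻³ ∫_{B(r)} |p₂|`                                     (∗)

(Seregin, arXiv:math/0510396, (p12): "The second component of the pressure is a harmonic
function and, therefore, satisfies the estimates `sup_{B(2/3)} |p²|^{3/2} ≤ c ∫_B |p²|^{3/2}`").
In the weak setting `p₂ = p - p₁` is only an `L¹` function satisfying `∫ p₂ Δφ = 0` for test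
functions supported in the ball, so (∗) must be read almost everywhere and proved through Weyl's
lemma. This file proves exactly that a.e. form, avoiding the full Weyl lemma:

* `exists_const_ae_abs_le_integral_of_weaklyHarmonic` — there is a universal `C` such that for
  every `h` integrable on `B(x₀, r)` with `∫ h Δφ = 0` for all `φ ∈ C_c^∞` supported in `B(x₀, r)`,
  `|h(x)| ≤ C r⁻³ ∫_{B(x₀,r)} |h|` for a.e. `x ∈ B(x₀, r/2)`.

## Proof

Let `g = 1_{B(x₀,r)} h ∈ L¹(ℝ³)` and `hₙ = ψₙ ⋆ g` its mollifications along a mollifier sequence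
(`exists_contDiffBump_seq`). (i) `hₙ` is smooth and **harmonic on `B(x₀, 3r/4)`** once the
mollification radius is `≤ r/8`: `Δ(ψₙ ⋆ g)(w) = ∫ g Δ[ψₙ(w - ·)] = ∫ h Δ[ψₙ(w - ·)] = 0`, the
reflected translate `ψₙ(w - ·)` being a test function supported in `B̄(w, r/8) ⊆ B(x₀, r)`
(`laplacian_convolution_lsmul`, `laplacian_comp_sub_left`, the easy half of Weyl's lemma as in
`TsaiSelfSimilarPressureProofs.lean`). (ii) The **mean value property on a ball**
(`eq_integral_newtonFarLaplacian_mul_of_laplacian_eq_zero`, with the smooth radial weight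
`λ = λ^{r/8, r/4}` of `NewtonKernel.lean`, supported in `|z| ≤ r/4`, and
`|λ^{r/8,r/4}| ≤ 8³ r⁻³ sup|λ^{1,2}|` by `newtonFarLaplacian_scale`) gives for `x ∈ B(x₀, r/2)`
`|hₙ(x)| = |∫ λ(z) hₙ(x - z) dz| ≤ C r⁻³ ‖hₙ‖_{L¹} ≤ C r⁻³ ‖g‖_{L¹} = C r⁻³ ∫_{B(x₀,r)} |h|`
(Young: `eLpNorm_normed_convolution_le`). (iii) `hₙ → g = h` a.e. on the ball (Lebesgue
differentiation, `ae_tendsto_normed_convolution`), and the bound passes to the limit.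

## References

* D. Gilbarg, N. S. Trudinger, *Elliptic partial differential equations of second order*
  (2001), Thm. 2.1 (mean value) and the remark after Thm. 2.10 (interior estimates); Weyl's
  lemma, §2.3. [`GilbargTrudinger2001`]
* G. Seregin, *Navier–Stokes equations: almost `L_{3,∞}`-case*, J. Math. Fluid Mech. 9 (2007) =
  arXiv:math/0510396, §2 (p12). [`Seregin2005`]
* W. Rusin, V. Šverák, J. Funct. Anal. 260 (2011) = arXiv:0911.0500, proof of Lemma 2.1
  ("The term `h^k` is handled by using classical estimates for harmonic functions").
  [`RusinSverak2011`]
-/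

noncomputable section

open MeasureTheory Set Function Filter Topology TopologicalSpace Metric
open scoped ENNReal NNReal Convolution ContDiff Laplacian

namespace Literature.Analysis.FluidPDE

/-! ### The weight `λ^{r/8, r/4}` and its sup bound -/

/-- A universal bound for the unit-scale weight `λ^{1,2} = Δ((1 - θ)Γ)` (continuous with compact
support). [folklore] -/
theorem exists_bound_newtonFarLaplacian_one_two :
    ∃ M : ℝ, 0 ≤ M ∧ ∀ z : EuclideanSpace ℝ (Fin 3), |newtonFarLaplacian 1 2 z| ≤ M := by
  obtain ⟨M, hM⟩ := (continuous_newtonFarLaplacian one_pos one_lt_two).bounded_above_of_compact_support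
    (hasCompactSupport_newtonFarLaplacian zero_le_one one_lt_two)
  refine ⟨M, (abs_nonneg _).trans ((Real.norm_eq_abs _).symm.le.trans (hM 0)), fun z => ?_⟩
  rw [← Real.norm_eq_abs]; exact hM z

/-- The weight at scale `c`: `|λ^{c, 2c}(z)| ≤ c⁻³ M` from `|λ^{1,2}| ≤ M`
(`newtonFarLaplacian_scale`). [folklore] -/
theorem abs_newtonFarLaplacian_scale_le {M c : ℝ} (hc : 0 < c)
    (hM : ∀ z : EuclideanSpace ℝ (Fin 3), |newtonFarLaplacian 1 2 z| ≤ M) (z : EuclideanSpace ℝ (Fin 3)) :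
    |newtonFarLaplacian (c * 1) (c * 2) z| ≤ c⁻¹ ^ 3 * M := by
  rw [newtonFarLaplacian_scale hc, abs_mul, abs_of_pos (by positivity)]
  exact mul_le_mul_of_nonneg_left (hM _) (by positivity)

/-! ### Mollifications of a weakly harmonic function are harmonic in the interior -/

/-- **Easy half of Weyl's lemma, local form.** Let `g ∈ L¹_loc(ℝ³)` agree with `h` on the open
ball `B(x₀, r)` and let `h` be weakly harmonic there: `∫ h Δφ = 0` for every `φ ∈ C_c^∞(ℝ³)`
with `tsupport φ ⊆ B(x₀, r)`. If `ψ` is a normalised bump of outer radius `δ` and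
`B̄(w, δ) ⊆ B(x₀, r)`, then `Δ(ψ ⋆ g)(w) = 0`. [cite: GilbargTrudinger2001, §2.3 (Weyl's lemma)] -/
theorem laplacian_normed_convolution_eq_zero {g h : EuclideanSpace ℝ (Fin 3) → ℝ}
    (hg : LocallyIntegrable g volume) {x₀ : EuclideanSpace ℝ (Fin 3)} {r : ℝ}
    (hgh : ∀ y ∈ ball x₀ r, g y = h y)
    (hharm : ∀ φ : EuclideanSpace ℝ (Fin 3) → ℝ, ContDiff ℝ (⊤ : ℕ∞) φ → HasCompactSupport φ →
      tsupport φ ⊆ ball x₀ r → ∫ x, h x * (Δ φ) x = 0)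
    (ψ : ContDiffBump (0 : EuclideanSpace ℝ (Fin 3))) {w : EuclideanSpace ℝ (Fin 3)}
    (hw : closedBall w ψ.rOut ⊆ ball x₀ r) :
    (Δ (ψ.normed volume ⋆[ContinuousLinearMap.lsmul ℝ ℝ, volume] g)) w = 0 := by
  set ψn : EuclideanSpace ℝ (Fin 3) → ℝ := ψ.normed volume with hψn
  have hψ2 : ContDiff ℝ 2 ψn := ψ.contDiff_normed
  have hψc : HasCompactSupport ψn := ψ.hasCompactSupport_normed
  rw [laplacian_convolution_lsmul hψ2 hψc hg w, convolution_def]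
  simp only [ContinuousLinearMap.lsmul_apply, smul_eq_mul]
  -- the reflected translate `θ = ψ(w - ·)` is a test function supported in `B̄(w, δ) ⊆ B(x₀, r)`
  set θ : EuclideanSpace ℝ (Fin 3) → ℝ := fun y => ψn (w - y) with hθ
  have hθtest := FunctionSpaces.isTestFunctionOn_normed_comp_sub (μ := volume)
    (U := (⟨ball x₀ r, isOpen_ball⟩ : Opens (EuclideanSpace ℝ (Fin 3)))) ψ hw
  have hθsupp : tsupport θ ⊆ ball x₀ r := hθtest.tsupport_subset
  have hΔθ : ∀ y, (Δ θ) y = (Δ ψn) (w - y) := fun y => laplacian_comp_sub_left hψ2 w y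
  -- `∫ Δψ(w - y) g(y) dy = ∫ h Δθ = 0`
  have key := hharm θ hθtest.contDiff hθtest.hasCompactSupport hθsupp
  have hpt : ∀ y, (Δ ψn) (w - y) * g y = h y * (Δ θ) y := by
    intro y
    rw [hΔθ y]
    by_cases hy : y ∈ ball x₀ r
    · rw [hgh y hy, mul_comm]
    · have hy' : y ∉ tsupport θ := fun h' => hy (hθsupp h')
      have h0 : (Δ θ) y = 0 := laplacian_eq_zero_of_notMem_tsupport hy'
      rw [hΔθ y] at h0
      rw [h0, zero_mul, mul_zero]
  -- substitute `t ↦ w - t` in the convolution integral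
  have e := integral_sub_left_eq_self (fun t => (Δ ψn) (w - t) * g t) volume w
  simp only [sub_sub_cancel] at e
  rw [e]
  simp_rw [hpt]
  exact key

/-! ### The interior estimate -/

/-- `∫ |g| = ∫_{B} |h|` for `g = 1_B h`. [folklore] -/
theorem integral_abs_indicator_ball (h : EuclideanSpace ℝ (Fin 3) → ℝ) (x₀ : EuclideanSpace ℝ (Fin 3)) (r : ℝ) :
    ∫ y, |(ball x₀ r).indicator h y| = ∫ y in ball x₀ r, |h y| := by
  rw [← integral_indicator measurableSet_ball]
  congr 1
  funext y
  by_cases hy : y ∈ ball x₀ r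
  · rw [indicator_of_mem hy, indicator_of_mem hy]
  · rw [indicator_of_notMem hy, indicator_of_notMem hy, abs_zero]

/-- **`L¹` contraction of mollification**, integral form: `∫ |ψ ⋆ g| ≤ ∫ |g|` for `g ∈ L¹`
(Young with the unit-mass kernel `ψ = φ.normed`; `eLpNorm_normed_convolution_le`). [folklore] -/
theorem integral_abs_normed_convolution_le {g : EuclideanSpace ℝ (Fin 3) → ℝ} (hg : Integrable g volume)
    (ψ : ContDiffBump (0 : EuclideanSpace ℝ (Fin 3))) :
    Integrable (ψ.normed volume ⋆[ContinuousLinearMap.lsmul ℝ ℝ, volume] g) volume ∧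
    ∫ y, |(ψ.normed volume ⋆[ContinuousLinearMap.lsmul ℝ ℝ, volume] g) y| ≤ ∫ y, |g y| := by
  have hmem : MemLp (ψ.normed volume ⋆[ContinuousLinearMap.lsmul ℝ ℝ, volume] g) 1 volume :=
    FunctionSpaces.memLp_normed_convolution ψ (memLp_one_iff_integrable.2 hg) le_rfl
  have hint : Integrable (ψ.normed volume ⋆[ContinuousLinearMap.lsmul ℝ ℝ, volume] g) volume :=
    memLp_one_iff_integrable.1 hmem
  refine ⟨hint, ?_⟩
  have hle := FunctionSpaces.eLpNorm_normed_convolution_le ψ hg.aestronglyMeasurable (p := 1) le_rfl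
  rw [eLpNorm_one_eq_lintegral_enorm, eLpNorm_one_eq_lintegral_enorm] at hle
  have e1 : ∫ y, |(ψ.normed volume ⋆[ContinuousLinearMap.lsmul ℝ ℝ, volume] g) y| =
      (∫⁻ y, ‖(ψ.normed volume ⋆[ContinuousLinearMap.lsmul ℝ ℝ, volume] g) y‖ₑ).toReal := by
    rw [← integral_norm_eq_lintegral_enorm hint.aestronglyMeasurable]
    simp only [Real.norm_eq_abs]
  have e2 : ∫ y, |g y| = (∫⁻ y, ‖g y‖ₑ).toReal := by
    rw [← integral_norm_eq_lintegral_enorm hg.aestronglyMeasurable]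
    simp only [Real.norm_eq_abs]
  rw [e1, e2]
  exact ENNReal.toReal_mono hg.2.ne hle

/-- **Mean value bound for a function harmonic on `B(x, r/4)`**: if `f ∈ C²(ℝ³)` is integrable,
`Δf = 0` on `B(x, r/4)` and `|λ^{1,2}| ≤ M`, then `|f(x)| ≤ 8³ M r⁻³ ∫ |f|`
(`eq_integral_newtonFarLaplacian_mul_of_laplacian_eq_zero` with the weight `λ^{r/8, r/4}`).
[cite: GilbargTrudinger2001, Thm. 2.1] -/
theorem abs_le_of_laplacian_eq_zero_ball {f : EuclideanSpace ℝ (Fin 3) → ℝ} (hf : ContDiff ℝ 2 f)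
    (hfi : Integrable f volume) {x : EuclideanSpace ℝ (Fin 3)} {r : ℝ} (hr : 0 < r)
    (hΔ : ∀ w ∈ ball x (r / 4), (Δ f) w = 0) {M : ℝ}
    (hM : ∀ z : EuclideanSpace ℝ (Fin 3), |newtonFarLaplacian 1 2 z| ≤ M) :
    |f x| ≤ 8 ^ 3 * M * (r ^ 3)⁻¹ * ∫ y, |f y| := by
  set c : ℝ := r / 8 with hc
  have hc0 : 0 < c := by positivity
  have h1 : c * 1 = r / 8 := by rw [hc]; ring
  have h2 : c * 2 = r / 4 := by rw [hc]; ring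
  have hmv := eq_integral_newtonFarLaplacian_mul_of_laplacian_eq_zero (r₀ := c * 1) (r₁ := c * 2)
    (by positivity) (by nlinarith) hf (y := x) (by rw [h2]; exact hΔ)
  set lam := newtonFarLaplacian (c * 1) (c * 2) with hlam
  have hB : ∀ z, |lam z| ≤ c⁻¹ ^ 3 * M := fun z => abs_newtonFarLaplacian_scale_le hc0 hM z
  have hK0 : 0 ≤ c⁻¹ ^ 3 * M := (abs_nonneg _).trans (hB 0)
  -- integrability of the integrand of the mean value formula
  have hlamc : Continuous lam := continuous_newtonFarLaplacian (by positivity) (by nlinarith)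
  have hlams : HasCompactSupport lam := hasCompactSupport_newtonFarLaplacian (by positivity) (by nlinarith)
  have hfc : Continuous fun z => f (x - z) := hf.continuous.comp (continuous_const.sub continuous_id)
  have hI : Integrable (fun z => lam z * f (x - z)) volume :=
    (hlamc.mul hfc).integrable_of_hasCompactSupport hlams.mul_right
  have hI2 : Integrable (fun z => |f (x - z)|) volume := by
    have := hfi.comp_sub_left x
    exact this.abs
  calc |f x| = |∫ z, lam z * f (x - z)| := by rw [hmv]
    _ ≤ ∫ z, |lam z * f (x - z)| := abs_integral_le_integral_abs
    _ ≤ ∫ z, (c⁻¹ ^ 3 * M) * |f (x - z)| := by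
        refine integral_mono hI.abs (hI2.const_mul _) fun z => ?_
        rw [abs_mul]
        exact mul_le_mul_of_nonneg_right (hB z) (abs_nonneg _)
    _ = (c⁻¹ ^ 3 * M) * ∫ z, |f (x - z)| := integral_const_mul _ _
    _ = (c⁻¹ ^ 3 * M) * ∫ z, |f z| := by
        rw [integral_sub_left_eq_self (fun z => |f z|) volume x]
    _ = 8 ^ 3 * M * (r ^ 3)⁻¹ * ∫ y, |f y| := by
        rw [hc]
        field_simp

/-- **Interior `L^∞–L¹` estimate for weakly harmonic functions** (Gilbarg–Trudinger, Thm. 2.1 and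
the interior estimates of §2.7, in the a.e. form needed for `L¹` weak solutions of `Δh = 0`;
Seregin 2005, (p12): "The second component of the pressure is a harmonic function and,
therefore, satisfies the estimates `sup_{B(2/3)} |p²|^{3/2} ≤ c ∫_B |p²|^{3/2}`"). There is a
universal constant `C` such that for every `h : ℝ³ → ℝ` integrable on a ball `B(x₀, r)` and weakly
harmonic there — `∫ h Δφ = 0` for all `φ ∈ C_c^∞(ℝ³)` with `tsupport φ ⊆ B(x₀, r)` — one has
`|h(x)| ≤ C r⁻³ ∫_{B(x₀,r)} |h|` for a.e. `x ∈ B(x₀, r/2)`. Proof: module docstring (mollify,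
mean value on `B(x, r/4)`, `L¹` contraction, a.e. convergence of mollifications).
[cite: GilbargTrudinger2001, Thm. 2.1 and §2.7; Seregin2005 §2 (p12)] -/
theorem exists_const_ae_abs_le_integral_of_weaklyHarmonic :
    ∃ C : ℝ, 0 ≤ C ∧ ∀ (h : EuclideanSpace ℝ (Fin 3) → ℝ) (x₀ : EuclideanSpace ℝ (Fin 3)) (r : ℝ),
      0 < r → IntegrableOn h (ball x₀ r) volume →
      (∀ φ : EuclideanSpace ℝ (Fin 3) → ℝ, ContDiff ℝ (⊤ : ℕ∞) φ → HasCompactSupport φ →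
        tsupport φ ⊆ ball x₀ r → ∫ x, h x * (Δ φ) x = 0) →
      ∀ᵐ x ∂(volume.restrict (ball x₀ (r / 2))), |h x| ≤ C * (r ^ 3)⁻¹ * ∫ y in ball x₀ r, |h y| := by
  obtain ⟨M, hM0, hM⟩ := exists_bound_newtonFarLaplacian_one_two
  refine ⟨8 ^ 3 * M, by positivity, fun h x₀ r hr hint hharm => ?_⟩
  -- `g = 1_B h ∈ L¹`
  set g : EuclideanSpace ℝ (Fin 3) → ℝ := (ball x₀ r).indicator h with hg
  have hgi : Integrable g volume := hint.integrable_indicator measurableSet_ball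
  have hgl : LocallyIntegrable g volume := hgi.locallyIntegrable
  have hgh : ∀ y ∈ ball x₀ r, g y = h y := fun y hy => indicator_of_mem hy h
  -- mollifier sequence and a.e. convergence
  obtain ⟨ψ, hψ0, hψ2⟩ := FunctionSpaces.exists_contDiffBump_seq (E := EuclideanSpace ℝ (Fin 3))
  have hconv := FunctionSpaces.ae_tendsto_normed_convolution hψ0 hψ2 hgl
  -- eventually the mollification radius is `≤ r/8`
  have hev : ∀ᶠ n in atTop, (ψ n).rOut < r / 8 :=
    (tendsto_order.1 hψ0).2 _ (by positivity)
  -- the bound for the mollifications at points of `B(x₀, r/2)`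
  have hbound : ∀ n, (ψ n).rOut < r / 8 → ∀ x ∈ ball x₀ (r / 2),
      |((ψ n).normed volume ⋆[ContinuousLinearMap.lsmul ℝ ℝ, volume] g) x| ≤
        8 ^ 3 * M * (r ^ 3)⁻¹ * ∫ y in ball x₀ r, |h y| := by
    intro n hn x hx
    set f := (ψ n).normed volume ⋆[ContinuousLinearMap.lsmul ℝ ℝ, volume] g with hfdef
    have hf2 : ContDiff ℝ 2 f := (ψ n).hasCompactSupport_normed.contDiff_convolution_left _
      (ψ n).contDiff_normed hgl
    obtain ⟨hfi, hfle⟩ := integral_abs_normed_convolution_le hgi (ψ n)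
    -- harmonic on `B(x, r/4)`
    have hΔ : ∀ w ∈ ball x (r / 4), (Δ f) w = 0 := by
      intro w hw
      refine laplacian_normed_convolution_eq_zero hgl hgh hharm (ψ n) ?_
      intro y hy
      rw [mem_closedBall] at hy
      rw [mem_ball] at hx hw ⊢
      calc dist y x₀ ≤ dist y w + dist w x + dist x x₀ := dist_triangle4 _ _ _ _
        _ < (ψ n).rOut + r / 4 + r / 2 := by linarith
        _ < r := by linarith
    calc |f x| ≤ 8 ^ 3 * M * (r ^ 3)⁻¹ * ∫ y, |f y| := abs_le_of_laplacian_eq_zero_ball hf2 hfi hr hΔ hM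
      _ ≤ 8 ^ 3 * M * (r ^ 3)⁻¹ * ∫ y, |g y| :=
          mul_le_mul_of_nonneg_left hfle (by positivity)
      _ = 8 ^ 3 * M * (r ^ 3)⁻¹ * ∫ y in ball x₀ r, |h y| := by rw [hg, integral_abs_indicator_ball]
  -- pass to the limit
  have hconv' := ae_restrict_of_ae (s := ball x₀ (r / 2)) hconv
  filter_upwards [hconv', ae_restrict_mem measurableSet_ball] with x hx hxmem
  have hlim : Tendsto (fun n => |((ψ n).normed volume ⋆[ContinuousLinearMap.lsmul ℝ ℝ, volume] g) x|)
      atTop (𝓝 |g x|) := (continuous_abs.tendsto _).comp hx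
  have hgx : g x = h x := hgh x (ball_subset_ball (by linarith) hxmem)
  rw [← hgx]
  exact le_of_tendsto hlim (hev.mono fun n hn => hbound n hn x hxmem)

end Literature.Analysis.FluidPDE

end
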